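import Summits.CriticalPhenomena.LaceExpansionHighD.MeanFieldD10Stage1ST10RecordRev3   -- HOME draft typed/p13/ (L9: `ST10N.*` / `ST10R.*` records)
import Summits.CriticalPhenomena.LaceExpansionHighD.MeanFieldD10Stage1ST10TrueCounts  -- HOME draft typed/p13/ (typer g10 M4: `ST10T.cellST10N_dom_{i,o}`, `ST10T.*_ofTable`, `ST10True.*`)
import Summits.CriticalPhenomena.LaceExpansionHighD.MeanFieldD10Stage1StateRev3       -- tree (p339734): `D10.stateRev3_m_eq` (m = Γ₁/((2d−1)c_μ) in ℝ)
import Literature.Probability.FitznerVanDerHofstad2017.NobleAssumption43Relaxed        -- HOME draft typed/p13/NobleAssumption43Relaxed_DRAFT.lean (typer g11, generic d)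
import HarnessLib

/-!
# HOME DRAFT (pub-lace10 typer g11, 2026-08-23; NOT filed — lead RULING D29 (3); lands only after L1–L9 (+ M1–M4) of `typed/p13/LEVELC-CHAIN.md`;
# target if filed: `Summits/CriticalPhenomena/LaceExpansionHighD/MeanFieldD10Stage1ST10Relaxed.lean`) —
# `d = 10`, the LEVEL-C RECORD with its (S2a′) binders in RELAXED form: the four NON-diagrammatic fields of Assumption 4.3
# (`Ĝ ≥ 0`, App. D Step 1(b) `μ_p ≤ i.mu` / `p ≤ i.mub`, and display (4.34) `geom_lt_one`) are DERIVED INSIDE, not assumed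

CITATION HEADER.  Part of a certified REPRODUCTION of R. Fitzner, R. van der Hofstad, *Mean-field behavior for nearest-neighbor percolation in d > 10*,
EJP 22 (2017) no. 43 [FvdH17] and *Generalized approach to the non-backtracking lace expansion*, PTRF 169 (2017) 1041–1119 [NoBLE17], at `d = 10` on the
cell's typed ST10′ Stage-1 recipe (Level C).  This module is the `d = 10` twin — and, by one display, the extension — of the LANDED `d = 11` module
`MeanFieldD11Rev10S2aRelaxed` («the App.-D-Step-1 fields of the two (S2a) binders are consequences, not hypotheses»): pub-lace10 ESTIMATE-INVENTORY §3 row U-6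
(«(4.34) `geom_lt_one`: 50 l at Level C (kernel `norm_num`), 0 at U») done at Level C.

WHAT THIS MODULE DOES.  The Level-C records `D10.ST10N.meanField_full_d10_typedStage1_ST10` (instance N), `D10.ST10T.*_ofTable` (any `E ≤ dataN`) and
`D10.ST10True.*_trueCounts` (the TRUE walk counts; the lead's record of choice, bus l.460) take the two (S2a′) binders as `NobleAssumption43At 10 p S (cell)`, a
sixty-field record of which four fields are NOT diagrammatic estimates.  Here (§1) the constant side of those four fields is settled once for the `d = 10` tuple
`(Γ₁, c_μ) = (1.0155, 1.0035784…)` AT THE TYPED CELLS, generically in the table instance: `cell.mu = m = Γ₁/((2d−1)c_μ)` (state field, `D10.stateRev3_m_eq`),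
`cell.mub = z[s]` (`zAtQ`: `Γ₁/(2d−1)` at `o`, `1/(2d−1)` at `i`) — both count-free, by `rfl` + `norm_num` —, and the CONSTANT SIDE OF (4.34),
`Γ₁/(1 − m)·β^{abs}_{Ξ^ι} < 1` at `o` and `(1/(1 − 1/(2d−1)))·β^{abs}_{Ξ^ι} < 1` at `i`, which follows for every cell record dominated by the line-Rev3
literals (`.Dom inputs{O,I}Rev3`, the L8 kernel packages / typer g10's `ST10T.cellST10N_dom_{i,o}`) from the two literal inequalities
`1.0155/(1 − m)·0.0045943491724661161969 < 1` and `(19/18)·0.0042016052314862129673 < 1` (`norm_num`; left sides ≈ 4.93e-3 and ≈ 4.44e-3 — (4.34) holds at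
the `d = 10` record with a factor ≈ 200 to spare).  (§2) «relaxed ⟹ full» at the two points for any such cell record (generic transports of
`NobleAssumption43Relaxed`: Aizenman–Newman for `Ĝ ≥ 0`, App. D Step 1(b) from `f₁ ≤ Γ₁` on the window resp. `μ_p ≤ p_I` at the initial point, (4.34) from
the same a-priori bounds).  (§3) the records with BOTH binders relaxed: `ST10N.meanField_full_d10_typedStage1_ST10_relaxed` (+ `meanField_d10`,
`nobleBootstrapBound`), `ST10T.meanField_full_d10_typedStage1_ST10_ofTable_relaxed` (any `E ≤ dataN`), `ST10True.meanField_full_d10_typedStage1_ST10_trueCounts_relaxed`.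

REMAINING HYPOTHESES of the `_relaxed` records (ANALYTIC, NOT CITABLE as typed; no named fact is consumed): (S2a″) = [NoBLE17] Assumption 4.3 for the percolation
split WITHOUT its four non-diagrammatic fields — i.e. exactly the DIAGRAMMATIC DISPLAYS (4.30) (`mubOverMu`, `muMin`), (4.31)–(4.33), (4.35)–(4.48) with the
constants computed by the typed ST10′ recipe — at `p_I` with `cell .i` and on the window `(p_I, p_c)` under `f^{𝒮₇} ≤ Γ` with `cell .o`, in the shape
`NobleAssumption43RelaxedAt 10 p S cell` := «given `Ĝ_p ≥ 0` and (4.34), Assumption 4.3 with `cell.relaxMu`»; plus `R18` kernel-valid as before.  The `_relaxed`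
records are STRONGER than (imply) the L9 / M4 records (`NobleAssumption43At.relaxed`).  This is NOT Level U: no diagrammatic display is proved here.

HONEST FRAMING.  A re-packaging of hypotheses over the typed recipe + `norm_num` arithmetic on two landed-shape literals; no numeral of record, literal, row, table,
level or label changes; Level B stays CONDITIONAL on (S2a), every Level-C draft CONDITIONAL on (S2a′)/(S2a″) and UNFILED (D29 (3)); «unconditional» is claimed
nowhere; no sentence about any dimension other than `d = 10`.  T-2 dependence: only through the two `xiIotaAbs` literals of the cut (any cut within a factor
≈ 200 of the D55 candidate's passes §1 (iii)–(iv) unchanged in text).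

[cite: FitznerVanDerHofstad2016NoBLE, Assumption 4.3 (4.30)–(4.49) pp. 1086–1088, esp. (4.34) p. 1086; App. D Step 1(b) p. 1110; Thm. 2.10 / Prop. 2.11 pp. 1060–1061; Prop. 4.5(ii) p. 1088]
[cite: FitznerVanDerHofstad2017, Thm. 1.1 / Cor. 1.3 pp. 5–6; Assumption 5.7 (5.46) p. 50; (3.42); notebook Percolation.nb cells 3, 44]
[cite: AizenmanNewman1984, Lemma 3.3]
-/

set_option Elab.async false

noncomputable section

namespace Summit.CriticalPhenomena.LaceExpansionHighD

namespace D10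

open Literature.Barriers.CriticalPhenomena Literature.Probability.Percolation
open Literature.Probability.LatticeModels Literature.Probability.FitznerVanDerHofstad2017
open NoGoFrame (Pt)
open Stage1Cells (DataQ zAtQ dQ)
open Stage1Cells.CertD10 (P40 stateRev3 dataHi)
open Stage1Cells.CertD10.EvalRev3P40 (rho40 dataN)
open Stage1Cells.CertD10.ST10P40 (cellST10 cellST10N chi40 SQr SbQr dataTrue)
open Stage1Tails.Rem.ST10 (inpMajQ)

namespace Relax

/-! ## §1 The constant side of the four non-diagrammatic fields at the typed cells (`d = 10` tuple; generic in the table instance) -/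

/-- (i) the cell's `mu` field IS the state's `m` (count-free), for every table instance and tail reading. [cite: FitznerVanDerHofstad2017, notebook Percolation.nb cell 44 (transcript l.1214–1237)] -/
theorem inpMajQ_mu (E : DataQ) (s : Pt) (S Sb : Pt → Matrix (Fin 3) (Fin 3) ℚ) :
    (inpMajQ E P40 rho40 chi40 stateRev3 s S Sb).mu = ((stateRev3.m : ℚ) : ℝ) := rfl

/-- (ii) the cell's `mub` field IS `z[s]` (cell 3: `z[i] = 1/(2d−1)`, `z[o] = Γ₁/(2d−1)`; count-free), for every table instance and tail reading.
[cite: FitznerVanDerHofstad2017, notebook Percolation.nb cells 3, 44 (transcript l.171–175, 1214–1237)] -/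
theorem inpMajQ_mub (E : DataQ) (s : Pt) (S Sb : Pt → Matrix (Fin 3) (Fin 3) ℚ) :
    (inpMajQ E P40 rho40 chi40 stateRev3 s S Sb).mub = ((zAtQ P40 s stateRev3 : ℚ) : ℝ) := rfl

/-- `z[o] = Γ₁/(2·10−1) = 2031/38000` at the `d = 10` tuple. [cite: FitznerVanDerHofstad2017, notebook Percolation.nb cell 3 (transcript l.171–175)] -/
theorem zAtQ_o : zAtQ P40 .o stateRev3 = 2031 / 38000 := by norm_num [zAtQ, dQ, P40, stateRev3]

/-- `z[i] = 1/(2·10−1) = 1/19`. [cite: FitznerVanDerHofstad2017, notebook Percolation.nb cell 3 (transcript l.171–175)] -/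
theorem zAtQ_i : zAtQ P40 .i stateRev3 = 1 / 19 := by norm_num [zAtQ, dQ, P40]

/-- App. D Step 1(b), window, constant side: `Γ₁/((2d−1)c_μ) ≤ cell.mu` (equality: the state's `m`). [cite: FitznerVanDerHofstad2016NoBLE, App. D Step 1(b) p. 1110] -/
theorem stepOne_mu (E : DataQ) (s : Pt) (S Sb : Pt → Matrix (Fin 3) (Fin 3) ℚ) :
    GammaRev2 0 / ((2 * ((10 : ℕ) : ℝ) - 1) * cMuRev2) ≤ (inpMajQ E P40 rho40 chi40 stateRev3 s S Sb).mu := by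
  rw [inpMajQ_mu, D10.stateRev3_m_eq]; norm_num

/-- App. D Step 1(b), initial point, constant side: `p_I = 1/(2d−1) ≤ cell.mu` (`1/19 ≤ m = Γ₁/(19 c_μ)`, i.e. `c_μ ≤ Γ₁`). [cite: FitznerVanDerHofstad2016NoBLE, App. D Step 1(b) p. 1110; Assumption 4.3 (z = z_I) p. 1086] -/
theorem stepOne_mu_pI (E : DataQ) (s : Pt) (S Sb : Pt → Matrix (Fin 3) (Fin 3) ℚ) :
    1 / (2 * ((10 : ℕ) : ℝ) - 1) ≤ (inpMajQ E P40 rho40 chi40 stateRev3 s S Sb).mu := by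
  rw [inpMajQ_mu, D10.stateRev3_m_eq]; norm_num [GammaRev2, cMuRev2]

/-- App. D Step 1(b), window, constant side: `Γ₁/(2d−1) ≤ cell.mub` at `o` (equality: `z[o]`). [cite: FitznerVanDerHofstad2016NoBLE, App. D Step 1(b) p. 1110] -/
theorem stepOne_mub_o (E : DataQ) (S Sb : Pt → Matrix (Fin 3) (Fin 3) ℚ) :
    GammaRev2 0 / (2 * ((10 : ℕ) : ℝ) - 1) ≤ (inpMajQ E P40 rho40 chi40 stateRev3 .o S Sb).mub := by
  rw [inpMajQ_mub, zAtQ_o]; norm_num [GammaRev2]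

/-- initial point, constant side: `p_I = 1/(2d−1) ≤ cell.mub` at `i` (equality: `z[i]`). [cite: FitznerVanDerHofstad2016NoBLE, Assumption 4.3 (z = z_I) p. 1086] -/
theorem stepOne_mub_i (E : DataQ) (S Sb : Pt → Matrix (Fin 3) (Fin 3) ℚ) :
    1 / (2 * ((10 : ℕ) : ℝ) - 1) ≤ (inpMajQ E P40 rho40 chi40 stateRev3 .i S Sb).mub := by
  rw [inpMajQ_mub, zAtQ_i]; norm_num

/-- (iii) **the constant side of (4.34) at the window, AT THE LINE-Rev3 LITERAL**: `Γ₁/(1 − Γ₁/((2d−1)c_μ))·inputsORev3.xiIotaAbs < 1`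
(`1.0155/(1 − 0.0532568…)·0.0045943491724661161969 ≈ 4.93e-3 < 1`). [cite: FitznerVanDerHofstad2016NoBLE, Assumption 4.3 (4.34) p. 1086] [cite: FitznerVanDerHofstad2017, Assumption 5.7 (5.46) p. 50 ("verified explicitly in the Mathematica notebooks")] -/
theorem geom434_lit_o :
    GammaRev2 0 / (1 - GammaRev2 0 / ((2 * ((10 : ℕ) : ℝ) - 1) * cMuRev2)) * inputsORev3.xiIotaAbs < 1 := by
  norm_num [GammaRev2, cMuRev2, inputsORev3]

/-- (iv) **the constant side of (4.34) at the initial point, AT THE LINE-Rev3 LITERAL**: `(1/(1 − 1/19))·inputsIRev3.xiIotaAbs < 1`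
(`(19/18)·0.0042016052314862129673 ≈ 4.44e-3 < 1`). [cite: FitznerVanDerHofstad2016NoBLE, Assumption 4.3 (4.34) p. 1086] [cite: FitznerVanDerHofstad2017, Assumption 5.7 (5.46) p. 50] -/
theorem geom434_lit_i : 1 / (1 - 1 / (2 * ((10 : ℕ) : ℝ) - 1)) * inputsIRev3.xiIotaAbs < 1 := by
  norm_num [inputsIRev3]

/-- (4.34), window, constant side AT ANY CELL RECORD DOMINATED BY THE LITERAL (`c.xiIotaAbs ≤ inputsORev3.xiIotaAbs`). [cite: FitznerVanDerHofstad2016NoBLE, Assumption 4.3 (4.34) p. 1086] -/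
theorem geom434_o_of_dom {c : BetaMap.Inputs} (h : c.Dom inputsORev3) :
    GammaRev2 0 / (1 - GammaRev2 0 / ((2 * ((10 : ℕ) : ℝ) - 1) * cMuRev2)) * c.xiIotaAbs < 1 :=
  (mul_le_mul_of_nonneg_left h.xiIotaAbs (by norm_num [GammaRev2, cMuRev2])).trans_lt geom434_lit_o

/-- (4.34), initial point, constant side AT ANY CELL RECORD DOMINATED BY THE LITERAL (`c.xiIotaAbs ≤ inputsIRev3.xiIotaAbs`). [cite: FitznerVanDerHofstad2016NoBLE, Assumption 4.3 (4.34) p. 1086] -/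
theorem geom434_i_of_dom {c : BetaMap.Inputs} (h : c.Dom inputsIRev3) :
    1 / (1 - 1 / (2 * ((10 : ℕ) : ℝ) - 1)) * c.xiIotaAbs < 1 :=
  (mul_le_mul_of_nonneg_left h.xiIotaAbs (by norm_num)).trans_lt geom434_lit_i

/-! ## §2 relaxed ⟹ full at the two points of the `d = 10` record, for any literal-dominated cell record -/

/-- **window**: for a cell record `c` with the Step-1 constants of the tuple and `c.Dom inputsORev3`, on `p ∈ (p_I, p_c)` under `f^{𝒮₇}(p) ≤ Γ` (only `j = 0`,
`f₁(p) ≤ Γ₁ = 1.0155`, is used), the RELAXED Assumption 4.3 at `p` implies the full one: `Ĝ_p ≥ 0` (Aizenman–Newman), `μ_p ≤ Γ₁/(19 c_μ) ≤ c.mu`,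
`p ≤ Γ₁/19 ≤ c.mub` (App. D Step 1(b)), and (4.34) from these bounds and §1 (iii). [cite: FitznerVanDerHofstad2016NoBLE, App. D Step 1(b) p. 1110; Assumption 4.3 (4.34) p. 1086] [cite: AizenmanNewman1984, Lemma 3.3] -/
theorem at_o_of_relaxed {c : BetaMap.Inputs} (hmu : GammaRev2 0 / ((2 * ((10 : ℕ) : ℝ) - 1) * cMuRev2) ≤ c.mu)
    (hmub : GammaRev2 0 / (2 * ((10 : ℕ) : ℝ) - 1) ≤ c.mub) (hdom : c.Dom inputsORev3)
    {p : unitInterval} (hp : p ∈ Set.Ioo (nbwThresholdI 10) (criticalProbI 10))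
    (hf : ∀ j, nobleFOf (nobleTripleSnoc 10 ((1 : ℕ), (17 : ℕ), ({0} : Set (Site 10)))) cMuRev2 cWeightsRev2 j p ≤ GammaRev2 j)
    {S : NobleSplit 10 p} (h : NobleAssumption43RelaxedAt 10 p S c) : NobleAssumption43At 10 p S c :=
  h.toAt_of_nobleF1_le (by norm_num) hp.2 (by norm_num [cMuRev2]) (by norm_num [GammaRev2, cMuRev2]) (by simpa using hf 0)
    hmu hmub (geom434_o_of_dom hdom)

/-- **initial point `p_I = 1/19`**: for a cell record `c` with `1/19 ≤ c.mu`, `1/19 ≤ c.mub` and `c.Dom inputsIRev3`, the RELAXED Assumption 4.3 at `p_I`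
implies the full one, unconditionally in `p`: `Ĝ_{p_I} ≥ 0` (`p_I < p_c`), `μ_{p_I} ≤ p_I` ((3.42)), (4.34) from §1 (iv). [cite: FitznerVanDerHofstad2016NoBLE, Assumption 4.3 (z = z_I) p. 1086, (4.34) p. 1086] [cite: FitznerVanDerHofstad2017, (3.42)] [cite: AizenmanNewman1984, Lemma 3.3] -/
theorem at_i_of_relaxed {c : BetaMap.Inputs} (hmu : 1 / (2 * ((10 : ℕ) : ℝ) - 1) ≤ c.mu)
    (hmub : 1 / (2 * ((10 : ℕ) : ℝ) - 1) ≤ c.mub) (hdom : c.Dom inputsIRev3)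
    {S : NobleSplit 10 (nbwThresholdI 10)} (h : NobleAssumption43RelaxedAt 10 (nbwThresholdI 10) S c) :
    NobleAssumption43At 10 (nbwThresholdI 10) S c :=
  h.toAt_nbwThresholdI (by norm_num) hmu hmub (geom434_i_of_dom hdom)

/-- window, at the Level-C cells `cellST10 E .o` of a literal-dominated instance (`E = dataN`: L8 `ST10N.cellST10_dom_o`; `E = dataHi`: `ST10R.cellST10_dom_o`).
[cite: FitznerVanDerHofstad2016NoBLE, App. D Step 1(b) p. 1110; Assumption 4.3 (4.34) p. 1086] -/
theorem cellST10_at_o_of_relaxed (E : DataQ) (hdom : (cellST10 E .o).Dom inputsORev3)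
    {p : unitInterval} (hp : p ∈ Set.Ioo (nbwThresholdI 10) (criticalProbI 10))
    (hf : ∀ j, nobleFOf (nobleTripleSnoc 10 ((1 : ℕ), (17 : ℕ), ({0} : Set (Site 10)))) cMuRev2 cWeightsRev2 j p ≤ GammaRev2 j)
    {S : NobleSplit 10 p} (h : NobleAssumption43RelaxedAt 10 p S (cellST10 E .o)) : NobleAssumption43At 10 p S (cellST10 E .o) :=
  at_o_of_relaxed (stepOne_mu E .o (SQr E) (SbQr E)) (stepOne_mub_o E (SQr E) (SbQr E)) hdom hp hf h

/-- initial point, at the Level-C cells `cellST10 E .i` of a literal-dominated instance. [cite: FitznerVanDerHofstad2016NoBLE, Assumption 4.3 (z = z_I) p. 1086, (4.34) p. 1086] -/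
theorem cellST10_at_i_of_relaxed (E : DataQ) (hdom : (cellST10 E .i).Dom inputsIRev3)
    {S : NobleSplit 10 (nbwThresholdI 10)} (h : NobleAssumption43RelaxedAt 10 (nbwThresholdI 10) S (cellST10 E .i)) :
    NobleAssumption43At 10 (nbwThresholdI 10) S (cellST10 E .i) :=
  at_i_of_relaxed (stepOne_mu_pI E .i (SQr E) (SbQr E)) (stepOne_mub_i E (SQr E) (SbQr E)) hdom h

/-- window, at the generalised cells `cellST10N E .o` (tails at instance N's Neumann inverses) of ANY `E ≤ dataN` (typer g10 `ST10T.cellST10N_dom_o`).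
[cite: FitznerVanDerHofstad2016NoBLE, App. D Step 1(b) p. 1110; Assumption 4.3 (4.34) p. 1086] -/
theorem cellST10N_at_o_of_relaxed (E : DataQ) (hE : E.TabLE dataN P40.d)
    {p : unitInterval} (hp : p ∈ Set.Ioo (nbwThresholdI 10) (criticalProbI 10))
    (hf : ∀ j, nobleFOf (nobleTripleSnoc 10 ((1 : ℕ), (17 : ℕ), ({0} : Set (Site 10)))) cMuRev2 cWeightsRev2 j p ≤ GammaRev2 j)
    {S : NobleSplit 10 p} (h : NobleAssumption43RelaxedAt 10 p S (cellST10N E .o)) : NobleAssumption43At 10 p S (cellST10N E .o) :=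
  at_o_of_relaxed (stepOne_mu E .o (SQr dataN) (SbQr dataN)) (stepOne_mub_o E (SQr dataN) (SbQr dataN)) (ST10T.cellST10N_dom_o E hE) hp hf h

/-- initial point, at the generalised cells `cellST10N E .i` of ANY `E ≤ dataN` (typer g10 `ST10T.cellST10N_dom_i`). [cite: FitznerVanDerHofstad2016NoBLE, Assumption 4.3 (z = z_I) p. 1086, (4.34) p. 1086] -/
theorem cellST10N_at_i_of_relaxed (E : DataQ) (hE : E.TabLE dataN P40.d)
    {S : NobleSplit 10 (nbwThresholdI 10)} (h : NobleAssumption43RelaxedAt 10 (nbwThresholdI 10) S (cellST10N E .i)) :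
    NobleAssumption43At 10 (nbwThresholdI 10) S (cellST10N E .i) :=
  at_i_of_relaxed (stepOne_mu_pI E .i (SQr dataN) (SbQr dataN)) (stepOne_mub_i E (SQr dataN) (SbQr dataN)) (ST10T.cellST10N_dom_i E hE) h

end Relax

/-! ## §3 The `d = 10` Level-C records with BOTH (S2a′) binders RELAXED -/

/-- **`d = 10`, LEVEL C on line Rev3, instance ST10N, (S2a′) RELAXED: `MeanField 10`** (θ(p_c) = 0, γ = β = 1, δ = 2 in bounded-ratio form), CONDITIONAL on
(S2a″) ONLY = [NoBLE17] Assumption 4.3 for percolation on `ℤ¹⁰` WITHOUT its four non-diagrammatic fields — the diagrammatic displays (4.30)–(4.33), (4.35)–(4.48)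
with the constants computed by the typed ST10′ Stage-1 recipe with tails over the (δ) instance `dataN` (`cellST10 dataN .i` at `p_I`; `cellST10 dataN .o` on
`(p_I, p_c)` under `f^{𝒮₇} ≤ Γ`), in the shape `NobleAssumption43RelaxedAt` («given `Ĝ ≥ 0` and (4.34), Assumption 4.3 with `cell.relaxMu`»); `R18` kernel-valid.
`Ĝ ≥ 0`, App. D Step 1(b) and (4.34) are derived inside (§2).  STRONGER than `ST10N.meanField_full_d10_typedStage1_ST10`.
[cite: FitznerVanDerHofstad2017, Thm. 1.1 and Cor. 1.3 pp. 5–6 (shape of the conclusion)] [cite: FitznerVanDerHofstad2016NoBLE, Assumption 4.3 pp. 1086–1088; App. D Step 1(b) p. 1110] -/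
theorem ST10N.meanField_full_d10_typedStage1_ST10_relaxed
    (hI43 : NobleAssumption43RelaxedAt 10 (nbwThresholdI 10)
      (percolationNobleSplit 10 (nbwThresholdI 10) (by norm_num) (nbwThresholdI_lt_criticalProbI (by norm_num))) (cellST10 dataN .i))
    (hS43 : (RemValid 10 18 fun r => ((RemCertD10.R18 r : ℚ) : ℝ)) →
      ∀ (p : unitInterval) (hp : p ∈ Set.Ioo (nbwThresholdI 10) (criticalProbI 10)),
        (∀ j, nobleFOf (nobleTripleSnoc 10 ((1 : ℕ), (17 : ℕ), ({0} : Set (Site 10)))) cMuRev2 cWeightsRev2 j p ≤ GammaRev2 j) →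
          NobleAssumption43RelaxedAt 10 p (percolationNobleSplit 10 p (by norm_num) hp.2) (cellST10 dataN .o)) :
    MeanField 10 :=
  ST10N.meanField_full_d10_typedStage1_ST10 (Relax.cellST10_at_i_of_relaxed dataN ST10N.cellST10_dom_i hI43)
    (fun hR p hp hf => Relax.cellST10_at_o_of_relaxed dataN ST10N.cellST10_dom_o hp hf (hS43 hR p hp hf))

/-- **`d = 10`, LEVEL C on line Rev3, instance ST10N, (S2a′) RELAXED**: the triangle condition, `θ(p_c) = 0` and `β = 1` (bounded-ratio sense) on `ℤ¹⁰`.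
[cite: FitznerVanDerHofstad2016NoBLE, Thm. 2.10, Prop. 2.11, Prop. 4.5(ii); Assumption 4.3 pp. 1086–1088] [cite: FitznerVanDerHofstad2017, Thm. 1.1, Cor. 1.3; §§4–6] -/
theorem ST10N.meanField_d10_typedStage1_ST10_relaxed
    (hI43 : NobleAssumption43RelaxedAt 10 (nbwThresholdI 10)
      (percolationNobleSplit 10 (nbwThresholdI 10) (by norm_num) (nbwThresholdI_lt_criticalProbI (by norm_num))) (cellST10 dataN .i))
    (hS43 : (RemValid 10 18 fun r => ((RemCertD10.R18 r : ℚ) : ℝ)) →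
      ∀ (p : unitInterval) (hp : p ∈ Set.Ioo (nbwThresholdI 10) (criticalProbI 10)),
        (∀ j, nobleFOf (nobleTripleSnoc 10 ((1 : ℕ), (17 : ℕ), ({0} : Set (Site 10)))) cMuRev2 cWeightsRev2 j p ≤ GammaRev2 j) →
          NobleAssumption43RelaxedAt 10 p (percolationNobleSplit 10 p (by norm_num) hp.2) (cellST10 dataN .o)) :
    TriangleCondition 10 ∧ PercolationContinuity 10 ∧ BetaEqOneBoundedRatio 10 :=
  ST10N.meanField_d10_typedStage1_ST10 (Relax.cellST10_at_i_of_relaxed dataN ST10N.cellST10_dom_i hI43)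
    (fun hR p hp hf => Relax.cellST10_at_o_of_relaxed dataN ST10N.cellST10_dom_o hp hf (hS43 hR p hp hf))

/-- **`d = 10`, LEVEL C on line Rev3, instance ST10N, (S2a′) RELAXED: the NoBLE infrared bound `NobleBootstrapBound 10`**.
[cite: FitznerVanDerHofstad2016NoBLE, Thm. 2.10 (2.17) p. 1060 and Prop. 4.5(ii) p. 1088] -/
theorem ST10N.nobleBootstrapBound_d10_typedStage1_ST10_relaxed
    (hI43 : NobleAssumption43RelaxedAt 10 (nbwThresholdI 10)
      (percolationNobleSplit 10 (nbwThresholdI 10) (by norm_num) (nbwThresholdI_lt_criticalProbI (by norm_num))) (cellST10 dataN .i))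
    (hS43 : (RemValid 10 18 fun r => ((RemCertD10.R18 r : ℚ) : ℝ)) →
      ∀ (p : unitInterval) (hp : p ∈ Set.Ioo (nbwThresholdI 10) (criticalProbI 10)),
        (∀ j, nobleFOf (nobleTripleSnoc 10 ((1 : ℕ), (17 : ℕ), ({0} : Set (Site 10)))) cMuRev2 cWeightsRev2 j p ≤ GammaRev2 j) →
          NobleAssumption43RelaxedAt 10 p (percolationNobleSplit 10 p (by norm_num) hp.2) (cellST10 dataN .o)) :
    NobleBootstrapBound 10 :=
  ST10N.nobleBootstrapBound_d10_typedStage1_ST10 (Relax.cellST10_at_i_of_relaxed dataN ST10N.cellST10_dom_i hI43)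
    (fun hR p hp hf => Relax.cellST10_at_o_of_relaxed dataN ST10N.cellST10_dom_o hp hf (hS43 hR p hp hf))

/-- **`d = 10`, LEVEL C on line Rev3, ANY INSTANCE `E ≤ dataN`, (S2a′) RELAXED: `MeanField 10`**, CONDITIONAL on (S2a″) only — the diagrammatic displays of
Assumption 4.3 with the constants computed by the typed ST10′ recipe over `E` (`cellST10N E .i / .o`); `Ĝ ≥ 0`, App. D Step 1(b), (4.34) derived inside.
[cite: FitznerVanDerHofstad2017, Thm. 1.1 and Cor. 1.3 pp. 5–6 (shape of the conclusion)] [cite: FitznerVanDerHofstad2016NoBLE, Assumption 4.3 pp. 1086–1088; App. D Step 1(b) p. 1110] -/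
theorem ST10T.meanField_full_d10_typedStage1_ST10_ofTable_relaxed (E : DataQ) (hE : E.TabLE dataN P40.d)
    (hI43 : NobleAssumption43RelaxedAt 10 (nbwThresholdI 10)
      (percolationNobleSplit 10 (nbwThresholdI 10) (by norm_num) (nbwThresholdI_lt_criticalProbI (by norm_num))) (cellST10N E .i))
    (hS43 : (RemValid 10 18 fun r => ((RemCertD10.R18 r : ℚ) : ℝ)) →
      ∀ (p : unitInterval) (hp : p ∈ Set.Ioo (nbwThresholdI 10) (criticalProbI 10)),
        (∀ j, nobleFOf (nobleTripleSnoc 10 ((1 : ℕ), (17 : ℕ), ({0} : Set (Site 10)))) cMuRev2 cWeightsRev2 j p ≤ GammaRev2 j) →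
          NobleAssumption43RelaxedAt 10 p (percolationNobleSplit 10 p (by norm_num) hp.2) (cellST10N E .o)) :
    MeanField 10 :=
  ST10T.meanField_full_d10_typedStage1_ST10_ofTable E hE (Relax.cellST10N_at_i_of_relaxed E hE hI43)
    (fun hR p hp hf => Relax.cellST10N_at_o_of_relaxed E hE hp hf (hS43 hR p hp hf))

/-- **`d = 10`, LEVEL C on line Rev3, TRUE COUNTS, (S2a′) RELAXED: `MeanField 10`** (θ(p_c) = 0, γ = β = 1, δ = 2 in bounded-ratio form), CONDITIONAL on
(S2a″) ONLY = the DIAGRAMMATIC DISPLAYS (4.30)–(4.33), (4.35)–(4.48) of [NoBLE17] Assumption 4.3 for percolation on `ℤ¹⁰` with the constants computed by the typed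
ST10′ Stage-1 recipe with tails OVER THE TRUE WALK COUNTS (`cellST10N dataTrue .i` at `p_I`; `cellST10N dataTrue .o` on `(p_I, p_c)` under `f^{𝒮₇} ≤ Γ`), in
the shape `NobleAssumption43RelaxedAt`; `R18` kernel-valid.  The four non-diagrammatic fields — `Ĝ ≥ 0` (Aizenman–Newman), App. D Step 1(b) (`μ_p ≤ m`,
`p ≤ z[s]` from `f₁ ≤ Γ₁` resp. `μ_p ≤ p_I`), display (4.34) — are theorems inside.  STRONGER than `ST10True.meanField_full_d10_typedStage1_ST10_trueCounts`
(the lead's record of choice, bus l.460); this is the form a Level-U proof addresses display by display.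
[cite: FitznerVanDerHofstad2017, Thm. 1.1 and Cor. 1.3 pp. 5–6 (shape of the conclusion)] [cite: FitznerVanDerHofstad2016NoBLE, Assumption 4.3 pp. 1086–1088; App. D Step 1(b) p. 1110] -/
theorem ST10True.meanField_full_d10_typedStage1_ST10_trueCounts_relaxed
    (hI43 : NobleAssumption43RelaxedAt 10 (nbwThresholdI 10)
      (percolationNobleSplit 10 (nbwThresholdI 10) (by norm_num) (nbwThresholdI_lt_criticalProbI (by norm_num))) (cellST10N dataTrue .i))
    (hS43 : (RemValid 10 18 fun r => ((RemCertD10.R18 r : ℚ) : ℝ)) →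
      ∀ (p : unitInterval) (hp : p ∈ Set.Ioo (nbwThresholdI 10) (criticalProbI 10)),
        (∀ j, nobleFOf (nobleTripleSnoc 10 ((1 : ℕ), (17 : ℕ), ({0} : Set (Site 10)))) cMuRev2 cWeightsRev2 j p ≤ GammaRev2 j) →
          NobleAssumption43RelaxedAt 10 p (percolationNobleSplit 10 p (by norm_num) hp.2) (cellST10N dataTrue .o)) :
    MeanField 10 :=
  ST10T.meanField_full_d10_typedStage1_ST10_ofTable_relaxed dataTrue Stage1Cells.CertD10.ST10P40.dataTrue_tabLE hI43 hS43

/-- the relaxed record implies the unrelaxed one's hypotheses are WEAKER claims: any (S2a′) pair in the L9 shape yields the relaxed pair (so nothing is lost).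
[cite: FitznerVanDerHofstad2016NoBLE, Assumption 4.3 pp. 1086–1088] -/
theorem ST10True.relaxed_of_full
    (hI43 : NobleAssumption43At 10 (nbwThresholdI 10)
      (percolationNobleSplit 10 (nbwThresholdI 10) (by norm_num) (nbwThresholdI_lt_criticalProbI (by norm_num))) (cellST10N dataTrue .i))
    (hS43 : (RemValid 10 18 fun r => ((RemCertD10.R18 r : ℚ) : ℝ)) →
      ∀ (p : unitInterval) (hp : p ∈ Set.Ioo (nbwThresholdI 10) (criticalProbI 10)),
        (∀ j, nobleFOf (nobleTripleSnoc 10 ((1 : ℕ), (17 : ℕ), ({0} : Set (Site 10)))) cMuRev2 cWeightsRev2 j p ≤ GammaRev2 j) →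
          NobleAssumption43At 10 p (percolationNobleSplit 10 p (by norm_num) hp.2) (cellST10N dataTrue .o)) :
    NobleAssumption43RelaxedAt 10 (nbwThresholdI 10)
        (percolationNobleSplit 10 (nbwThresholdI 10) (by norm_num) (nbwThresholdI_lt_criticalProbI (by norm_num))) (cellST10N dataTrue .i) ∧
      ((RemValid 10 18 fun r => ((RemCertD10.R18 r : ℚ) : ℝ)) →
        ∀ (p : unitInterval) (hp : p ∈ Set.Ioo (nbwThresholdI 10) (criticalProbI 10)),
          (∀ j, nobleFOf (nobleTripleSnoc 10 ((1 : ℕ), (17 : ℕ), ({0} : Set (Site 10)))) cMuRev2 cWeightsRev2 j p ≤ GammaRev2 j) →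
            NobleAssumption43RelaxedAt 10 p (percolationNobleSplit 10 p (by norm_num) hp.2) (cellST10N dataTrue .o)) :=
  ⟨hI43.relaxed, fun hR p hp hf => (hS43 hR p hp hf).relaxed⟩

end D10

end Summit.CriticalPhenomena.LaceExpansionHighD

end
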